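import Literature.AnabelianGeometry.EtaleTheta.BiKummerOfModelCanonical
import Literature.AnabelianGeometry.EtaleTheta.Prop42Sub
import HarnessLib

/-!
# [EtTh] Prop. 4.2 (iii), sub-node L03 `BaseFrobeniusLift` AS TYPED, read at the canonical model
# instance: a kernel NEGATIVE (it forces `O^×(A_⊙) = {1}`)

Mochizuki, *The étale theta function and its Frobenioid-theoretic manifestations*, Publ. RIMS **45**
(2009), §4, Prop. 4.2 (iii), proof PDF p.89 L83 – p.90 L6 [cite: MochizukiEtTh2009, Prop 4.2 p.89]:
«since the Frobenioid `C` is of model [hence, in particular, pre-model] type [cf. Theorem 3.7, (i)], it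
follows that `C` admits a base-Frobenius pair [cf. [FrdI], Definition 2.7, (iii)]». PROOF-ONLY file
(abc-iut cell, writer abc-iut-w4-d044; node `EtTh:Prop4.2(iii)`, sub-DAG row `EtTh:Prop4.2(iii)/L03` of
`plan/L2/SUBDAG-EtTh-Prop42.md`) over abc-iut-w5-d134's statements file `Prop42Sub.lean`, abc-iut-L2-t3's
`BiKummerSetting`, abc-iut-L2-t9's `mkOfModelCanonical` and abc-iut-L1-t2's [FrdI] Def. 2.7
(`PreFrobenioid.IsBaseSection`, `Presection`). Nothing there is edited; no definition, no named fact.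

**What is shown.** The typed sub-node `Prop42Sub.BaseFrobeniusLift S` quantifies over an ARBITRARY
pull-back morphism `φ : A' → A_⊙` (from a Frobenius-trivial, Galois, `μ_N`-saturated `A'`) and asks for
base-Frobenius-type data `d` with `d.α₁ = φ` LITERALLY. Under the reading of Def. 4.1 (iv)(e) used by the
canonical model instance (`TemperedFrobenioid.ArisesFromBaseFrobeniusPair`: `α'` is `P`-DISTINGUISHED for a
base-Frobenius pair `(P, F)` of `C`) this forces every unit of `A_⊙` to be trivial
(`Prop42Sub.isUnitTrivial_Aodot_of_baseFrobeniusLift`): take `N := 1`, `A' := A_⊙`, `φ := u` a unit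
(an isomorphism is a pull-back morphism; `A_⊙` is Frobenius-trivial and Galois by the setting; every
object is `μ_1`-saturated); then `u` is `P`-distinguished, and `P ↪ C → D` being an equivalence ([FrdI]
Def. 2.7 (i)(c)), hence faithful, the `P`-arrows `u` and `id_{A_⊙}` over the same base map coincide.
Hence `¬ Prop42Sub.BaseFrobeniusLift (mkOfModelCanonical …)` as soon as `O^×(A_⊙)` has an element `≠ 1`
(`not_baseFrobeniusLift_mkOfModelCanonical`) — e.g. for the tempered Frobenioid of a curve, where
`O^×(A_⊙) ≅ O_L^×` (Prop. 3.4 (ii)).  More generally no `P`-distinguished arrow can be a `C`-isomorphism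
between DISTINCT objects (`P` is a skeleton), so a pull-back morphism `A' → A_⊙` with `A' ≠ A_⊙` and
`Base(A') ≅ Base(A_⊙)` is never distinguished either.

**Why print is not affected.** The printed proof CHOOSES the `N`-domain `A_N` (the Frobenius-trivial
object of `P` over the saturated covering) and `α'` (THE `P`-arrow over the base morphism); only the
sub-DAG's universal quantification over a given `(A', φ)` with `d.α₁ = φ` pinned is too strong. A
print-faithful replacement (L03′: `φ` distinguished UP TO A UNIT of `A'`, with the degenerate case
`Base(A') ≅ Base(A_⊙)` treated separately) is recorded on the cell's STATUS/INBOX (2026-08-26) for the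
row holder and the L2 lead; the compositions `prop42_iii_of_subnodes` are unaffected in form.
HONEST FRAMING: a statement about the TYPED intermediate row only; [EtTh] Prop. 4.2 (iii) itself is not
claimed false; typed ≠ proved; nothing here takes a side on [IUTchIII] Cor. 3.12.
-/

namespace Literature.AnabelianGeometry.EtaleTheta

open CategoryTheory Opposite Literature.AlgebraicGeometry.Frobenioids

universe u₀ v₀ u v w

variable {K : Type u₀} [Field K]

namespace BiKummerSetting

variable {X : SemiGraphs.TemperedArithmeticGroup.{u₀} K} {D₀ : Type u₀} [Category.{v₀} D₀]
  {V : FrdIMonoidStub.{w}} {T : RealifiedDivisorMonoids (D₀ := D₀) V} {D : Type u} [Category.{v} D]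
  {VD : FrdICatStub.{u, v, w} D} (S : BiKummerSetting X T D VD)

namespace Prop42Sub

/-! ### `P`-distinguished arrows are determined by their base -/

/-- For a base-section `P` of `C` ([FrdI] Def. 2.7 (i): `P ↪ C → D` is an equivalence, in particular
faithful), two `P`-distinguished arrows with the same base map are equal.
[cite: MochizukiFrdI2008, Def. 2.7(i) p.51] -/
theorem eq_of_isDistinguished_of_baseMap_eq {Pr : Presection S.C}
    (hP : PreFrobenioid.IsBaseSection S.F Pr) {A B : S.C} {f g : A ⟶ B} (hf : Pr.hom f)
    (hg : Pr.hom g) (h : ModelFrobenioid.baseMap f = ModelFrobenioid.baseMap g) : f = g := by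
  haveI := hP.isEquivalence
  let A' : Pr.Cat := ⟨A, (Pr.obj_of_hom f hf).1⟩
  let B' : Pr.Cat := ⟨B, (Pr.obj_of_hom f hf).2⟩
  let f' : A' ⟶ B' := ⟨f, hf⟩
  let g' : A' ⟶ B' := ⟨g, hg⟩
  have hfg : f' = g' :=
    (Pr.toBase S.F).map_injective (show (Pr.toBase S.F).map f' = (Pr.toBase S.F).map g' from h)
  exact congrArg Subtype.val hfg

/-- A `P`-distinguished UNIT is trivial: `u ∈ O^×(A)` with `u ∈ P` equals `id_A` (compare with the
`P`-arrow `id_A` over the same base). [cite: MochizukiFrdI2008, Def. 2.7(i) p.51] -/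
theorem unit_eq_one_of_isDistinguished {Pr : Presection S.C} (hP : PreFrobenioid.IsBaseSection S.F Pr)
    {A : S.C} {u : Aut A} (hu : u ∈ S.units A) (hd : Pr.hom u.hom) : u = 1 := by
  have hb : ModelFrobenioid.baseMap u.hom = ModelFrobenioid.baseMap (𝟙 A) := by
    rw [ModelFrobenioid.baseMap_id]; exact hu.1
  exact Iso.ext (eq_of_isDistinguished_of_baseMap_eq S hP hd (Pr.hom_id (Pr.obj_of_hom _ hd).1) hb)

/-- A `P`-distinguished ISOMORPHISM of `C` has equal source and target (`P` is a skeleton, [FrdI] Def.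
2.7 (i)(a); the inverse base map lifts to `P` by fullness and the composites are identities by
faithfulness). [cite: MochizukiFrdI2008, Def. 2.7(i) p.51] -/
theorem eq_of_isDistinguished_of_isIso {Pr : Presection S.C} (hP : PreFrobenioid.IsBaseSection S.F Pr)
    {A B : S.C} {φ : A ⟶ B} [IsIso φ] (hd : Pr.hom φ) : A = B := by
  haveI := hP.isEquivalence
  let b : A.base ⟶ B.base := ModelFrobenioid.baseMap φ
  haveI : IsIso b := ModelFrobenioid.isIso_baseMap_of_isIso φ
  let A' : Pr.Cat := ⟨A, (Pr.obj_of_hom φ hd).1⟩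
  let B' : Pr.Cat := ⟨B, (Pr.obj_of_hom φ hd).2⟩
  let φ' : A' ⟶ B' := ⟨φ, hd⟩
  -- lift the inverse base map to `P`
  let binv : B.base ⟶ A.base := inv b
  let ψ' : B' ⟶ A' :=
    (Pr.toBase S.F).preimage (show (Pr.toBase S.F).obj B' ⟶ (Pr.toBase S.F).obj A' from binv)
  have hψ : ModelFrobenioid.baseMap ψ'.1 = inv b :=
    (Pr.toBase S.F).map_preimage (show (Pr.toBase S.F).obj B' ⟶ (Pr.toBase S.F).obj A' from binv)
  have h₁ : φ' ≫ ψ' = 𝟙 A' := by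
    apply (Pr.toBase S.F).map_injective
    show ModelFrobenioid.baseMap (φ ≫ ψ'.1) = ModelFrobenioid.baseMap (𝟙 A)
    rw [ModelFrobenioid.baseMap_comp, hψ, ModelFrobenioid.baseMap_id]
    exact IsIso.hom_inv_id b
  have h₂ : ψ' ≫ φ' = 𝟙 B' := by
    apply (Pr.toBase S.F).map_injective
    show ModelFrobenioid.baseMap (ψ'.1 ≫ φ) = ModelFrobenioid.baseMap (𝟙 B)
    rw [ModelFrobenioid.baseMap_comp, hψ, ModelFrobenioid.baseMap_id]
    exact IsIso.inv_hom_id b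
  have hAB : A' = B' := hP.isSkeleton A' B' ⟨⟨φ', ψ', h₁, h₂⟩⟩
  exact congrArg Subtype.val hAB

/-! ### Every object is `μ_1`-saturated -/

/-- `μ_1(A) = {1}` is generated by the element `1` of order `1`: every object is `μ_1`-saturated
([FrdII] Def. 2.1 (i)). [cite: MochizukiEtTh2009, Def 4.1 p.87] -/
theorem isMuSaturated_one (A : S.C) : S.IsMuSaturated A 1 := by
  refine ⟨1, ⟨(S.units A).one_mem, by rw [PNat.one_coe, pow_one]⟩, ?_, ?_⟩
  · rw [orderOf_one, PNat.one_coe]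
  · rintro τ ⟨-, hτ⟩
    rw [PNat.one_coe, pow_one] at hτ
    rw [hτ]
    exact Subgroup.one_mem _

/-! ### The negative -/

/-- **L03 AS TYPED forces `O^×(A_⊙) = {1}`** for every setting whose Def. 4.1 (iv)(e) predicate implies
the canonical reading (`α'` distinguished for a base-Frobenius pair of `C`; definitional for
`mkOfModelCanonical`): witness `N := 1`, `A' := A_⊙`, `φ := u ∈ O^×(A_⊙)`.
[cite: MochizukiEtTh2009, Prop 4.2 p.89] -/
theorem isUnitTrivial_Aodot_of_baseFrobeniusLift
    (hE : ∀ {A B : S.C} (G : Subgroup (Aut A)) (α₂ : A ⟶ A) (α₁ : A ⟶ B),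
      S.ArisesFromBaseFrobeniusPair G α₂ α₁ → S.tf.ArisesFromBaseFrobeniusPair G α₂ α₁)
    (h₃ : BaseFrobeniusLift S) : PreFrobenioid.IsUnitTrivial S.F S.Aodot := by
  intro u hu
  obtain ⟨α, d, hd, -, -⟩ := h₃ 1 S.Aodot u.hom (PreFrobenioid.isPullbackMorphism_of_isIso S.F u.hom)
    S.isFrobeniusTrivial_Aodot S.isGalois_Aodot (isMuSaturated_one S S.Aodot)
  obtain ⟨Pr, Fr, hPF, -, hα₁, -⟩ := hE _ _ _ d.cond_e
  rw [hd] at hα₁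
  exact unit_eq_one_of_isDistinguished S hPF.isBaseSection hu hα₁

/-- Hence **`¬ BaseFrobeniusLift`** (canonical reading) as soon as `A_⊙` has a unit `≠ 1`.
[cite: MochizukiEtTh2009, Prop 4.2 p.89] -/
theorem not_baseFrobeniusLift_of_unit
    (hE : ∀ {A B : S.C} (G : Subgroup (Aut A)) (α₂ : A ⟶ A) (α₁ : A ⟶ B),
      S.ArisesFromBaseFrobeniusPair G α₂ α₁ → S.tf.ArisesFromBaseFrobeniusPair G α₂ α₁)
    {u : Aut S.Aodot} (hu : u ∈ S.units S.Aodot) (hu1 : u ≠ 1) : ¬ BaseFrobeniusLift S :=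
  fun h₃ => hu1 (isUnitTrivial_Aodot_of_baseFrobeniusLift S hE h₃ u hu)

/-- The same obstruction for the general shape «`d.α₁` is the given `φ`»: under the canonical reading NO
base-Frobenius-type data has as pull-back part a `C`-isomorphism between distinct objects (in particular
a pull-back morphism `A' → A_⊙` from a unit- or class-twist `A' ≠ A_⊙` of `A_⊙` over an isomorphic base).
[cite: MochizukiEtTh2009, Def 4.1 p.87] -/
theorem eq_of_baseFrobeniusTypeData_of_isIso
    (hE : ∀ {A B : S.C} (G : Subgroup (Aut A)) (α₂ : A ⟶ A) (α₁ : A ⟶ B),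
      S.ArisesFromBaseFrobeniusPair G α₂ α₁ → S.tf.ArisesFromBaseFrobeniusPair G α₂ α₁)
    {A B : S.C} {α : A ⟶ B} (d : S.BaseFrobeniusTypeData α) [IsIso d.α₁] : A = B := by
  obtain ⟨Pr, Fr, hPF, -, hα₁, -⟩ := hE _ _ _ d.cond_e
  exact eq_of_isDistinguished_of_isIso S hPF.isBaseSection hα₁

end Prop42Sub

section Canonical

variable (X) (tf : TemperedFrobenioid T D VD) (hZ : tf.monoidType = MonoidType.Z)
  (hP : ∀ A : Dᵒᵖ, IsPerfect (tf.Φ.carrier A)) (IG : D → Prop) (gS : ∀ A : D, IG A → (X.Pi →* Aut A))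
  (gSs : ∀ (A : D) (h : IG A), Function.Surjective (gS A h))
  (NH : Subgroup (Field.absoluteGaloisGroup K) → tf.category → ℕ+ → Prop) (A₀ : tf.category)
  (hA₀ : PreFrobenioid.IsFrobeniusTrivial tf.toElem A₀) (hA₀' : IG A₀.base)

/-- **L03 AS TYPED at the CANONICAL MODEL INSTANCE forces `O^×(A_⊙) = {1}`** (Def. 4.1 (iv)(e) :=
`TemperedFrobenioid.ArisesFromBaseFrobeniusPair`, abc-iut-L2-t9). [cite: MochizukiEtTh2009, Prop 4.2 p.89] -/
theorem isUnitTrivial_of_baseFrobeniusLift_mkOfModelCanonical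
    (h₃ : Prop42Sub.BaseFrobeniusLift (mkOfModelCanonical X tf hZ hP IG gS gSs NH A₀ hA₀ hA₀')) :
    PreFrobenioid.IsUnitTrivial tf.toElem A₀ :=
  Prop42Sub.isUnitTrivial_Aodot_of_baseFrobeniusLift
    (mkOfModelCanonical X tf hZ hP IG gS gSs NH A₀ hA₀ hA₀') (fun _ _ _ h => h) h₃

/-- **`¬ L03` at the canonical model instance, given a non-trivial unit of `A_⊙`.**
[cite: MochizukiEtTh2009, Prop 4.2 p.89] -/
theorem not_baseFrobeniusLift_mkOfModelCanonical {u : Aut A₀} (hu : u ∈ tf.units A₀) (hu1 : u ≠ 1) :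
    ¬ Prop42Sub.BaseFrobeniusLift (mkOfModelCanonical X tf hZ hP IG gS gSs NH A₀ hA₀ hA₀') :=
  Prop42Sub.not_baseFrobeniusLift_of_unit
    (mkOfModelCanonical X tf hZ hP IG gS gSs NH A₀ hA₀ hA₀') (fun _ _ _ h => h) hu hu1

end Canonical

end BiKummerSetting

end Literature.AnabelianGeometry.EtaleTheta
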